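import Mathlib
import HarnessLib
import Literature.MathematicalPhysics.QuantumLattice.HubbardUVSymbolCTDifferences
import Summits.HubbardSuperconductivity.HubbardSuperconductivity.Theorems.KLProgrammeKLRegimeEngineScaleZeroSmearingSecondOrderBound
import Summits.HubbardSuperconductivity.HubbardSuperconductivity.Theorems.KLProgrammeKLRegimeEngineScaleZeroSmearingTail
import Summits.HubbardSuperconductivity.HubbardSuperconductivity.Theorems.KLProgrammeKLRegimeEnginePairTransferBaseScaleZero

/-!
# K3 ENGINE-FLOW child (stmt-HubbardSuperconductivity-20437 `KLRegimeEngineV17F2`), located «(X).2′-BASE-ROOM», cure (β) «SCALE0-MEMBER-DIFF», part F5: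
# THE MEMBER DIFFERENCE OF THE SCALE-`0` PAIR AMPLITUDE, CLOSED — `160·klIdxMass 0 j′·U² + (2²⁰/12108³)·CV·ThetaC²·klIdxMass 0 j′·U³`

Cell `gate-hubbard-kl`, seat hubbard-kl-k3c5-p1 (g22).  The sq-twin of k3c1-p1 g14's `klmg_memberAmplitude_sub_le_sq` (`(4/6047)·klIdxMass 0 j′·klTransferC R·U²`,
`klTransferC R ≥ 2¹⁰²`) with the second order made EXPLICIT: F3's momentum-space bound of the explicit part (`40·U²·S_C·Σ‖s_d‖/|βL²|³`, hard line by its sup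
`S_C = 2βL²/e₀ = 64βL²` — the cutoff support, `norm_uvSymbolCT_le_two_mul_div` — and the member-difference line by its entry sum `Σ‖s_d‖ = 2(βL²)²·e₀·klSoftMass ≤
2(βL²)²·e₀·klIdxMass 0 j′`, `sum_norm_softSymbol_eq` + `klSoftMass_compl_sub_compl_le_klIdxMass`) plus F4b's tail in k3c2-p1 g5's step data at the tree's constants
(`κ₀ = ρ = √12108`, `γ² = 6047`, `κD² = e₀·klIdxMass 0 j′ ≤ 15367/32`, `(N/β)·‖Ṽ‖_h ≤ CV·U`, `θ ≤ ThetaC·U ≤ 1/4`):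

* **`norm_klCovSmearedPairAmplitude_member_sub_le_secondOrder`** — for `R.WF`, `0 < U ≤ 1`, `FrameOK R U N μ K`, `klBetaMin ≤ β ≤ L`, `β³ ≤ M`,
  `klScaleZeroThetaC R·U ≤ 1/4`, `j′ ≤ j`, every `Q, k, k′`:
  `‖𝒜₀[S_{0,j}](Q;k,k′) − 𝒜₀[S_{0,j′}](Q;k,k′)‖ ≤ 160·klIdxMass 0 j′·U² + (2²⁰/12108³)·klScaleZeroCV R·klScaleZeroThetaC R²·klIdxMass 0 j′·U³` —
  the `U²` coefficient is the ABSOLUTE `160` (no `Klam`, no determinant constant); the determinant constants moved to the `U³` tail.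

This is the theorem (β) of the located item; re-keying the class-#5 base row `hbase` of «95v2» to it (a `U`-inhomogeneous scalar row, dischargeable for
`U ≤ U₀(P,R)`) is the k3c1 lineage's REPAIR-DUTY plumbing.  Nothing here asserts row (X), any stub of 20437, K3, U₀ or superconductivity.
References: BGM 2006 §2.2, (2.77)–(2.80), (2.86)–(2.90) [cite: BenfattoGiulianiMastropietro2006]; Salmhofer 1999 §4.2.5 (4.70)–(4.71) [cite: Salmhofer1999].
-/

noncomputable section

namespace Summit.HubbardSuperconductivity.HubbardSuperconductivity.Theorems.EngineV8

set_option linter.dupNamespace false -- summit = problem name (single-conjunct summit), D-0017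

open Real Finset Literature.MathematicalPhysics.QuantumLattice Literature.Probability.LatticeModels
open Summit.HubbardSuperconductivity.HubbardSuperconductivity.Theorems.KLRegimeSplit
open Summit.HubbardSuperconductivity.HubbardSuperconductivity.Theorems.KLProgrammeLegKernels
open Summit.HubbardSuperconductivity.HubbardSuperconductivity.Theorems.ScaleZeroDecay

variable {L M : ℕ} [NeZero L]

/-! ## §1 Symbol sizes: the hard line by its sup, the member-difference line by its entry sum -/


/-- `‖(iω + ξ)/(ω² + ξ²)‖ ≤ 1/√(ω² + ξ²)`-type bound in the form `‖(iω + ξ)/((ω² + ξ² : ℝ) : ℂ)‖ * √(ω² + ξ²) ≤ 1`. -/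
theorem norm_I_mul_add_div_sq_eq (ω ξ : ℝ) :
    ‖(Complex.I * (ω : ℂ) + (ξ : ℂ)) / (((ω ^ 2 + ξ ^ 2 : ℝ)) : ℂ)‖ = (Real.sqrt (ω ^ 2 + ξ ^ 2))⁻¹ := by
  have hnum : ‖Complex.I * (ω : ℂ) + (ξ : ℂ)‖ = Real.sqrt (ω ^ 2 + ξ ^ 2) := by
    rw [Complex.norm_eq_sqrt_sq_add_sq]
    congr 1
    simp [Complex.add_re, Complex.add_im, Complex.mul_re, Complex.mul_im]
    ring
  rw [norm_div, hnum, Complex.norm_real, Real.norm_eq_abs, abs_of_nonneg (by positivity)]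
  by_cases h0 : ω ^ 2 + ξ ^ 2 = 0
  · rw [h0, Real.sqrt_zero]; simp
  · have hpos : 0 < ω ^ 2 + ξ ^ 2 := lt_of_le_of_ne (by positivity) (Ne.symm h0)
    have hs : 0 < Real.sqrt (ω ^ 2 + ξ ^ 2) := Real.sqrt_pos.2 hpos
    rw [eq_comm, inv_eq_iff_eq_inv, inv_div, eq_div_iff hs.ne']
    exact Real.mul_self_sqrt hpos.le

/-- **The ultraviolet symbol is bounded by `2βL²/Λ`**: the cutoff weight vanishes where `ω² + e_K² ≤ Λ²/4`, and is `≤ 1` elsewhere, where `1/√(ω² + e_K²) < 2/Λ`.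
[cite: Salmhofer1999, §4.2.5 (4.70)-(4.71)] -/
theorem norm_uvSymbolCT_le_two_mul_div {β : ℝ} (hβ : 0 < β) (μ : ℝ) (K : TrigPolyC4v) {Λ : ℝ} (hΛ : 0 < Λ) (ks : FreqMomentum L M × Fin 2) :
    ‖uvSymbolCT L M β μ K Λ ks‖ ≤ 2 * (β * (L : ℝ) ^ 2) / Λ := by
  have hL : (0 : ℝ) < L := by exact_mod_cast Nat.pos_of_ne_zero (NeZero.ne L)
  have hβL : 0 < β * (L : ℝ) ^ 2 := by positivity
  set s : ℝ := matsubaraFreq β M ks.1.1 ^ 2 + nambuXiCT L μ K ks.1.2 ^ 2 with hs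
  have hs0 : 0 ≤ s := by positivity
  have hden : (nambuDenCT L M β μ 0 K ks.1 : ℝ) = s := by rw [nambuDenCT_zero_seed]
  have hw : hubbardCutoffWeightCT L M β μ K Λ ks.1 = salmhoferCutoff (s / Λ ^ 2) := rfl
  unfold uvSymbolCT
  rw [hden, norm_mul, norm_mul, Complex.norm_real, Complex.norm_real, Real.norm_eq_abs, Real.norm_eq_abs, abs_of_pos hβL, hw,
    abs_of_nonneg (salmhoferCutoff_mem_Icc _).1, norm_I_mul_add_div_sq_eq]
  by_cases hsmall : s / Λ ^ 2 ≤ 1 / 4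
  · rw [salmhoferCutoff_of_le hsmall, zero_mul]
    positivity
  · -- on the support `s > Λ²/4`, so `1/√s < 2/Λ`
    push Not at hsmall
    have hs4 : Λ ^ 2 / 4 < s := by
      rw [lt_div_iff₀ (by positivity)] at hsmall
      linarith
    have hsq : Λ / 2 < Real.sqrt s := by
      rw [show Λ / 2 = Real.sqrt ((Λ / 2) ^ 2) by rw [Real.sqrt_sq (by positivity)]]
      exact Real.sqrt_lt_sqrt (by positivity) (by linarith)
    have hspos : 0 < Real.sqrt s := lt_trans (by positivity) hsq
    have hinv : (Real.sqrt s)⁻¹ ≤ 2 / Λ := by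
      rw [inv_le_comm₀ hspos (by positivity), inv_div]
      exact hsq.le
    calc salmhoferCutoff (s / Λ ^ 2) * (β * (L : ℝ) ^ 2 * (Real.sqrt s)⁻¹)
        ≤ 1 * (β * (L : ℝ) ^ 2 * (2 / Λ)) :=
          mul_le_mul (salmhoferCutoff_mem_Icc _).2 (mul_le_mul_of_nonneg_left hinv hβL.le) (by positivity) zero_le_one
      _ = 2 * (β * (L : ℝ) ^ 2) / Λ := by ring

/-- **The entry sum of a soft symbol is `2βL² ×` its phase-space mass**: for a real weight `φ`,
`Σ_{(k,σ)} ‖φ(k)·βL²·(iω + e_K)/(ω² + e_K²)‖ = 2·(βL²)²·Λₙ·klSoftMass n φ` (any `n`; `klmg_mass_eq_klScale_mul_klSoftMass`). -/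
theorem sum_norm_softSymbol_eq {β : ℝ} (hβ : 0 < β) (μ : ℝ) (K : TrigPolyC4v) (n : ℕ) (φ : FreqMomentum L M → ℝ) :
    ∑ ks : FreqMomentum L M × Fin 2, ‖(φ ks.1 : ℂ) *
        (((β * (L : ℝ) ^ 2 : ℝ) : ℂ) * ((Complex.I * matsubaraFreq β M ks.1.1 + nambuXiCT L μ K ks.1.2) / nambuDenCT L M β μ 0 K ks.1))‖ =
      2 * (β * (L : ℝ) ^ 2) ^ 2 * (klScale klE0 n * klSoftMass L M β μ K n φ) := by
  have hL : (0 : ℝ) < L := by exact_mod_cast Nat.pos_of_ne_zero (NeZero.ne L)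
  have hβL : 0 < β * (L : ℝ) ^ 2 := by positivity
  rw [← klmg_mass_eq_klScale_mul_klSoftMass L M hβ μ K n φ, Fintype.sum_prod_type]
  simp only [Finset.sum_const, Finset.card_univ, Fintype.card_fin]
  rw [Finset.mul_sum, Finset.mul_sum]
  refine Finset.sum_congr rfl fun k _ => ?_
  have hden : (nambuDenCT L M β μ 0 K k : ℝ) = matsubaraFreq β M k.1 ^ 2 + nambuXiCT L μ K k.2 ^ 2 := by rw [nambuDenCT_zero_seed]
  rw [norm_mul, norm_mul, Complex.norm_real, Complex.norm_real, Real.norm_eq_abs, Real.norm_eq_abs, abs_of_pos hβL, hden, norm_I_mul_add_div_sq_eq,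
    div_eq_mul_inv]
  field_simp
  ring


/-! ## §2 The closed member difference -/

set_option maxHeartbeats 400000 in -- composition with the long step-data statements of F3/F4b (pre-budgeted, standing ask of the build lane)
/-- **THE MEMBER DIFFERENCE OF THE SCALE-`0` PAIR AMPLITUDE THROUGH EXPLICIT SECOND ORDER** (cure (β) of the located «(X).2′-BASE-ROOM»): for `R.WF`,
`0 < U ≤ 1`, `FrameOK R U N μ K`, `klBetaMin ≤ β ≤ L`, `β³ ≤ M`, `klScaleZeroThetaC R·U ≤ 1/4`, `j′ ≤ j` and every `Q, k, k′`,
`‖𝒜₀[S_{0,j}](Q;k,k′) − 𝒜₀[S_{0,j′}](Q;k,k′)‖ ≤ 160·klIdxMass 0 j′·U² + (2²⁰/12108³)·klScaleZeroCV R·klScaleZeroThetaC R²·klIdxMass 0 j′·U³`.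
[cite: BenfattoGiulianiMastropietro2006, §2.2 (2.12)-(2.14) and (2.86)-(2.90)] -/
theorem norm_klCovSmearedPairAmplitude_member_sub_le_secondOrder [NeZero M] {R : RenConsts} (hR : R.WF) {U : ℝ} (hU : 0 < U) (hU1 : U ≤ 1)
    {Nsc : ℕ} {μ : ℝ} {K : TrigPolyC4v} (hK : FrameOK R U Nsc μ K) {β : ℝ} (hβ : klBetaMin ≤ β) (hβL : β ≤ L)
    (hβM : β ^ 3 ≤ (M : ℝ)) (hθ : klScaleZeroThetaC R * U ≤ 1 / 4) {j j' : ℕ} (hj : j' ≤ j) (Qm k k' : TorusSite 2 L) :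
    ‖klCovSmearedPairAmplitude L M β U μ K 0 (softCovOf L M β μ K (softSymbolCompl L M β μ K 0 j)) Qm k k' -
        klCovSmearedPairAmplitude L M β U μ K 0 (softCovOf L M β μ K (softSymbolCompl L M β μ K 0 j')) Qm k k'‖ ≤
      160 * klIdxMass 0 j' * U ^ 2 + 2 ^ 20 / 12108 ^ 3 * klScaleZeroCV R * klScaleZeroThetaC R ^ 2 * klIdxMass 0 j' * U ^ 3 := by
  -- notation and signs (as in `klmg_memberAmplitude_sub_le_sq`)
  set Ng : ℕ := 2 * (2 * M) with hNg
  haveI : NeZero Ng := ⟨by rw [hNg]; have := NeZero.ne M; omega⟩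
  have hβ0 : 0 < β := pos_of_klBetaMin_le hβ
  have hL : (0 : ℝ) < L := by exact_mod_cast Nat.pos_of_ne_zero (NeZero.ne L)
  have hβL2 : 0 < β * (L : ℝ) ^ 2 := by positivity
  have hN0 : 0 < ((Ng : ℕ) : ℝ) := by exact_mod_cast Nat.pos_of_ne_zero (NeZero.ne Ng)
  have hUabs : |U| = U := abs_of_pos hU
  have hU1' : |U| ≤ 1 := by rwa [hUabs]
  have hG0 : 0 ≤ R.Gfr 0 := hR.2.2 0
  have hΛ : 0 < klScale klE0 0 := klth_klScale_pos 0
  have hΛv : klScale klE0 0 = 1 / 32 := by simp [klScale, klE0]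
  set ms : ℝ := klIdxMass 0 j' with hms
  have hms0 : 0 ≤ ms := klIdxMass_nonneg 0 j'
  have hmsle : ms ≤ 15367 := klIdxMass_le 0 j'
  -- the two lines
  set sd : FreqMomentum L M × Fin 2 → ℂ := fun ks => (((softSymbolCompl L M β μ K 0 j - softSymbolCompl L M β μ K 0 j') ks.1 : ℝ) : ℂ) *
    (((β * (L : ℝ) ^ 2 : ℝ) : ℂ) * ((Complex.I * matsubaraFreq β M ks.1.1 + nambuXiCT L μ K ks.1.2) / nambuDenCT L M β μ 0 K ks.1)) with hsd
  have hd : softCovOf L M β μ K (softSymbolCompl L M β μ K 0 j - softSymbolCompl L M β μ K 0 j') = normalCovariance L M sd := rfl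
  have hsplit : softCovOf L M β μ K (softSymbolCompl L M β μ K 0 j) = softCovOf L M β μ K (softSymbolCompl L M β μ K 0 j') + normalCovariance L M sd := by
    rw [klmf_softCovOf_eq_sub_add L M β μ K (softSymbolCompl L M β μ K 0 j) (softSymbolCompl L M β μ K 0 j'), add_comm, hd]
  set sC : FreqMomentum L M × Fin 2 → ℂ := uvSymbolCT L M β μ K (klScale klE0 0) with hsC
  have hC : hubbardCovAboveCT L M β μ 0 K (klScale klE0 0) = normalCovariance L M sC := hubbardCovAboveCT_zero_seed_eq_normalCovariance_uvSymbolCT β μ K _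
  have hSC : ∀ p, ‖sC p‖ ≤ 2 * (β * (L : ℝ) ^ 2) / klScale klE0 0 := fun p => norm_uvSymbolCT_le_two_mul_div hβ0 μ K hΛ p
  -- the entry sum of the member-difference symbol
  have hsd_sum : ∑ p, ‖sd p‖ ≤ 2 * (β * (L : ℝ) ^ 2) ^ 2 * (klScale klE0 0 * ms) := by
    rw [hsd, sum_norm_softSymbol_eq hβ0 μ K 0 (softSymbolCompl L M β μ K 0 j - softSymbolCompl L M β μ K 0 j')]
    refine mul_le_mul_of_nonneg_left (mul_le_mul_of_nonneg_left ?_ hΛ.le) (by positivity)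
    exact klSoftMass_compl_sub_compl_le_klIdxMass β μ K hK hβ hβL (Nat.zero_le j') hj
  -- (1) THE EXPLICIT PART ≤ 160·ms·U²
  have hexp := norm_klCovSmearedPairAmplitude_zero_add_sub_sub_tail_le β U μ K sC sd hSC hC (softCovOf L M β μ K (softSymbolCompl L M β μ K 0 j')) Qm k k'
  have hexp' : 40 * U ^ 2 * (2 * (β * (L : ℝ) ^ 2) / klScale klE0 0) * (∑ p, ‖sd p‖) / |β * (L : ℝ) ^ 2| ^ 3 ≤ 160 * ms * U ^ 2 := by
    rw [abs_of_pos hβL2, div_le_iff₀ (by positivity)]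
    calc 40 * U ^ 2 * (2 * (β * (L : ℝ) ^ 2) / klScale klE0 0) * ∑ p, ‖sd p‖
        ≤ 40 * U ^ 2 * (2 * (β * (L : ℝ) ^ 2) / klScale klE0 0) * (2 * (β * (L : ℝ) ^ 2) ^ 2 * (klScale klE0 0 * ms)) :=
          mul_le_mul_of_nonneg_left hsd_sum (by positivity)
      _ = 160 * ms * U ^ 2 * (β * (L : ℝ) ^ 2) ^ 3 := by field_simp; ring
  -- (2) THE TAIL ≤ (2²⁰/12108³)·CV·ThetaC²·ms·U³ — k3c2-p1 g5's step data at the bare-frame constants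
  set κ₀ : ℝ := Real.sqrt (2 * (7 + 6047)) with hκ₀
  have hκ : 0 < κ₀ := Real.sqrt_pos.2 (by norm_num)
  have hκ2 : κ₀ ^ 2 = 12108 := by rw [hκ₀, Real.sq_sqrt (by norm_num)]; norm_num
  have hκi2 : κ₀⁻¹ ^ 2 = 1 / 12108 := by rw [inv_pow, hκ2, one_div]
  have hA0 := klScaleZeroA0_pos
  have hCV := klScaleZeroCV_pos hG0
  set α : ℝ := ((Ng : ℕ) : ℝ) / β * klScaleZeroA0 with hα
  have hαpos : 0 < α := by positivity
  have hrow := fun X => rowSum_scaleZero_le_A0 (L := L) (μ := μ) hK hβ hβM X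
  have hcol := fun Y => colSum_scaleZero_le_A0 (L := L) (μ := μ) hK hβ hβM Y
  set kK : ℝ := klKappaFrameC R * |U| with hkK
  have hkKframe : ∑ z : TorusSite 2 L, ‖framePosKernel L K z‖ ≤ kK := sum_norm_framePosKernel_le_linear_of_frameOK hR hU.ne' hU1' hK
  set N₁ : ℝ := |β| / Ng * kK with hN₁
  have hkK0 : 0 ≤ kK := by rw [hkK]; exact mul_nonneg (klKappaFrameC_pos hG0).le (abs_nonneg U)
  have hN₁0 : 0 ≤ N₁ := by positivity
  have hct : ∀ (j : Fin 2) (w : GridLeg (GridPoint L Ng)),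
      ∑ Y ∈ univ.filter (fun Y : Fin 2 → GridLeg (GridPoint L Ng) => Y j = w), ‖kernel ℂ (hubbardGridCounterQuadratic L Ng β K) 2 Y‖ ≤ N₁ := fun j w =>
    (sum_norm_kernel_hubbardGridCounterQuadratic_le_l1 β K j w).trans (mul_le_mul_of_nonneg_left hkKframe (by positivity))
  set V : ℝ := normV (GridLeg (GridPoint L Ng)) κ₀ κ₀ (fun m' : ℕ => if m' = 1 then N₁ else if m' = 2 then |U| * |β| / (Ng : ℕ) else 0) with hV
  have hVeq : V = (Real.exp 2 * (κ₀ + κ₀)) ^ 2 * (|β| / Ng * kK) + (Real.exp 2 * (κ₀ + κ₀)) ^ 4 * (|U| * |β| / Ng) := by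
    rw [hV, hN₁]
    exact normV_scaleZeroPinnedL1_eq four_le_card_gridLeg κ₀ κ₀ β U kK Ng
  have hNV : ((Ng : ℕ) : ℝ) / β * V ≤ klScaleZeroCV R * U := by
    rw [hVeq, abs_of_pos hβ0, hkK, hUabs, klScaleZeroCV, ← hκ₀, show κ₀ + κ₀ = 2 * κ₀ by ring]
    have h2 : 0 ≤ (Real.exp 2 * (2 * κ₀)) ^ 2 := sq_nonneg _
    have h4 : 0 ≤ (Real.exp 2 * (2 * κ₀)) ^ 4 := by positivity
    have hKC : 0 ≤ klKappaFrameC R := (klKappaFrameC_pos hG0).le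
    refine le_of_eq ?_
    field_simp
  have hV0 : 0 ≤ V := by rw [hV]; exact normV_nonneg hκ.le hκ.le (klsv_profile_nonneg β U Ng hN₁0)
  set θ : ℝ := Real.exp 1 * α * V / κ₀ ^ 2 with hθdef
  have hθle : θ ≤ klScaleZeroThetaC R * U := by
    have h1 : θ = Real.exp 1 * klScaleZeroA0 * (((Ng : ℕ) : ℝ) / β * V) / κ₀ ^ 2 := by rw [hθdef, hα]; ring
    rw [h1, klScaleZeroThetaC, ← hκ₀]
    have : Real.exp 1 * klScaleZeroA0 * (((Ng : ℕ) : ℝ) / β * V) ≤ Real.exp 1 * klScaleZeroA0 * (klScaleZeroCV R * U) :=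
      mul_le_mul_of_nonneg_left hNV (by positivity)
    calc Real.exp 1 * klScaleZeroA0 * (((Ng : ℕ) : ℝ) / β * V) / κ₀ ^ 2
        ≤ Real.exp 1 * klScaleZeroA0 * (klScaleZeroCV R * U) / κ₀ ^ 2 := div_le_div_of_nonneg_right this (by positivity)
      _ = _ := by ring
  have hθq : θ ≤ 1 / 4 := hθle.trans hθ
  have hθ0 : 0 ≤ θ := by positivity
  have hθ1 : θ < 1 := by linarith
  have hTC0 : 0 ≤ klScaleZeroThetaC R * U := hθ0.trans hθle
  -- Gram constants of the two soft lines and the two smallness conditions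
  have hGBγ := isGramBoundedR_gridSub_softSubCov_zero (M := M) hK hβ hβL
    (isSoftSubCov_softCovOf (isSoftSymbol_compl (L := L) (M := M) β μ K (Nat.zero_le j')))
  have hGBD := klmg_isGramBoundedR_gridSub_dLine L M hK hβ hβL (Nat.zero_le j') hj Ng
  have hκD2 : Real.sqrt (klScale klE0 0 * klIdxMass 0 j') ^ 2 = klScale klE0 0 * ms := by rw [Real.sq_sqrt (mul_nonneg hΛ.le hms0)]
  have hγ2 : Real.sqrt 6047 ^ 2 = 6047 := Real.sq_sqrt (by norm_num)
  have hy : 4 * (Real.sqrt 6047 ^ 2 * θ * κ₀⁻¹ ^ 2) ≤ 1 / 2 := by rw [hγ2, hκi2]; linarith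
  have hz : 16 * (Real.sqrt (klScale klE0 0 * klIdxMass 0 j') ^ 2 * θ * κ₀⁻¹ ^ 2) ≤ 1 / 2 := by
    rw [hκD2, hκi2, hΛv]
    have hmt : ms * θ ≤ 15367 * (1 / 4) := mul_le_mul hmsle hθq hθ0 (by norm_num)
    have hre3 : 16 * (1 / 32 * ms * θ * (1 / 12108 : ℝ)) = ms * θ / 24216 := by ring
    rw [hre3, div_le_iff₀ (by norm_num)]
    linarith
  have htail := norm_vertexFn_smearedTail_sub_le_of_gridStep (L := L) (M := M) hβ0 U μ K hκ (isGramBoundedR_scaleZero_of_frameOK_sharp hK hβ hβL) hαpos hrow hcol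
    hκ hN₁0 hct hθ1 (D' := softCovOf L M β μ K (softSymbolCompl L M β μ K 0 j'))
    (D₁ := softCovOf L M β μ K (softSymbolCompl L M β μ K 0 j - softSymbolCompl L M β μ K 0 j'))
    (γ := Real.sqrt 6047) (κD := Real.sqrt (klScale klE0 0 * klIdxMass 0 j'))
    (Real.sqrt_nonneg _) (Real.sqrt_nonneg _) hGBγ hGBD hy hz (pairLegs L M Qm k k')
  -- the tail's closed bound
  have htail' : 96 * ((Ng : ℕ) : ℝ) / β *
      (4096 * κ₀⁻¹ ^ 6 * Real.sqrt (klScale klE0 0 * klIdxMass 0 j') ^ 2 * (Real.exp 1 * V / (1 - θ) * (1 + 8 * (Real.sqrt 6047 ^ 2 * κ₀⁻¹ ^ 2))) *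
        θ ^ 2 * (1 + 32 * (Real.sqrt (klScale klE0 0 * klIdxMass 0 j') ^ 2 * κ₀⁻¹ ^ 2))) ≤
      2 ^ 20 / 12108 ^ 3 * klScaleZeroCV R * klScaleZeroThetaC R ^ 2 * ms * U ^ 3 := by
    rw [show κ₀⁻¹ ^ 6 = (κ₀⁻¹ ^ 2) ^ 3 by ring, hκD2, hγ2, hκi2, hΛv]
    have he : Real.exp 1 < 2.7182818286 := Real.exp_one_lt_d9
    have he0 : 0 < Real.exp 1 := Real.exp_pos 1
    have hfrac : 1 / (1 - θ) ≤ 4 / 3 := by rw [div_le_div_iff₀ (by linarith) (by norm_num)]; linarith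
    have hθsq : θ ^ 2 ≤ (klScaleZeroThetaC R * U) ^ 2 := pow_le_pow_left₀ hθ0 hθle 2
    -- regroup: `96·(Ng/β)·(4096 r³ κD² (e V/(1−θ) c₁) θ² c₂) = 96·4096·r³·e·c₁·c₂·κD²·((Ng/β)V)·(1/(1−θ))·θ²`
    have hre : 96 * ((Ng : ℕ) : ℝ) / β *
        (4096 * (1 / 12108 : ℝ) ^ 3 * (1 / 32 * ms) * (Real.exp 1 * V / (1 - θ) * (1 + 8 * (6047 * (1 / 12108 : ℝ)))) * θ ^ 2 *
          (1 + 32 * (1 / 32 * ms * (1 / 12108 : ℝ)))) =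
        (96 * 4096 * (1 / 12108 : ℝ) ^ 3 * (1 / 32)) * Real.exp 1 * ms * ((1 + 8 * (6047 * (1 / 12108 : ℝ))) * (1 + 32 * (1 / 32 * ms * (1 / 12108 : ℝ)))) *
          (((Ng : ℕ) : ℝ) / β * V) * (1 / (1 - θ)) * θ ^ 2 := by
      field_simp
    rw [hre]
    -- elementary factors and their sizes
    have he' : Real.exp 1 ≤ 2.7182818286 := he.le
    have hK0 : (0 : ℝ) ≤ 96 * 4096 * (1 / 12108 : ℝ) ^ 3 * (1 / 32) := by positivity
    have hC12_0 : 0 ≤ (1 + 8 * (6047 * (1 / 12108 : ℝ))) * (1 + 32 * (1 / 32 * ms * (1 / 12108 : ℝ))) := by positivity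
    have hc12 : (1 + 8 * (6047 * (1 / 12108 : ℝ))) * (1 + 32 * (1 / 32 * ms * (1 / 12108 : ℝ))) ≤ 15 := by
      have h1 : 0 ≤ 1 + 32 * (1 / 32 * ms * (1 / 12108 : ℝ)) := by positivity
      have hc1 : (1 + 8 * (6047 * (1 / 12108 : ℝ))) ≤ 5 := by norm_num
      have hc2 : (1 + 32 * (1 / 32 * ms * (1 / 12108 : ℝ))) ≤ 3 := by
        have hre2 : 32 * (1 / 32 * ms * (1 / 12108 : ℝ)) = ms / 12108 := by ring
        have hle2 : ms / 12108 ≤ 2 := by rw [div_le_iff₀ (by norm_num)]; linarith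
        rw [hre2]; linarith
      exact (mul_le_mul hc1 hc2 h1 (by norm_num)).trans (by norm_num)
    have hX1_0 : 0 ≤ ((Ng : ℕ) : ℝ) / β * V := mul_nonneg (div_nonneg (Nat.cast_nonneg _) hβ0.le) hV0
    have hX2_0 : 0 ≤ 1 / (1 - θ) := div_nonneg zero_le_one (by linarith)
    have hCVU : 0 ≤ klScaleZeroCV R * U := mul_nonneg hCV.le hU.le
    have hEC : Real.exp 1 * ((1 + 8 * (6047 * (1 / 12108 : ℝ))) * (1 + 32 * (1 / 32 * ms * (1 / 12108 : ℝ)))) ≤ 2.7182818286 * 15 :=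
      mul_le_mul he' hc12 hC12_0 (by norm_num)
    have hX23 : 1 / (1 - θ) * θ ^ 2 ≤ 4 / 3 * (klScaleZeroThetaC R * U) ^ 2 := mul_le_mul hfrac hθsq (sq_nonneg θ) (by norm_num)
    have hX123 : ((Ng : ℕ) : ℝ) / β * V * (1 / (1 - θ) * θ ^ 2) ≤ klScaleZeroCV R * U * (4 / 3 * (klScaleZeroThetaC R * U) ^ 2) :=
      mul_le_mul hNV hX23 (mul_nonneg hX2_0 (sq_nonneg θ)) hCVU
    have hP : 0 ≤ klScaleZeroCV R * klScaleZeroThetaC R ^ 2 * ms * U ^ 3 :=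
      mul_nonneg (mul_nonneg (mul_nonneg hCV.le (sq_nonneg _)) hms0) (pow_nonneg hU.le 3)
    calc (96 * 4096 * (1 / 12108 : ℝ) ^ 3 * (1 / 32)) * Real.exp 1 * ms * ((1 + 8 * (6047 * (1 / 12108 : ℝ))) * (1 + 32 * (1 / 32 * ms * (1 / 12108 : ℝ)))) *
          (((Ng : ℕ) : ℝ) / β * V) * (1 / (1 - θ)) * θ ^ 2
        = (96 * 4096 * (1 / 12108 : ℝ) ^ 3 * (1 / 32)) * ms *
            (Real.exp 1 * ((1 + 8 * (6047 * (1 / 12108 : ℝ))) * (1 + 32 * (1 / 32 * ms * (1 / 12108 : ℝ))))) *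
            (((Ng : ℕ) : ℝ) / β * V * (1 / (1 - θ) * θ ^ 2)) := by ring
      _ ≤ (96 * 4096 * (1 / 12108 : ℝ) ^ 3 * (1 / 32)) * ms * (2.7182818286 * 15) * (klScaleZeroCV R * U * (4 / 3 * (klScaleZeroThetaC R * U) ^ 2)) :=
          mul_le_mul (mul_le_mul_of_nonneg_left hEC (mul_nonneg hK0 hms0)) hX123 (mul_nonneg hX1_0 (mul_nonneg hX2_0 (sq_nonneg θ)))
            (mul_nonneg (mul_nonneg hK0 hms0) (by norm_num))
      _ = (96 * 4096 * (1 / 32) * 2.7182818286 * 15 * (4 / 3)) * ((1 / 12108 : ℝ) ^ 3 * (klScaleZeroCV R * klScaleZeroThetaC R ^ 2 * ms * U ^ 3)) := by ring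
      _ ≤ 2 ^ 20 * ((1 / 12108 : ℝ) ^ 3 * (klScaleZeroCV R * klScaleZeroThetaC R ^ 2 * ms * U ^ 3)) :=
          mul_le_mul_of_nonneg_right (by norm_num) (mul_nonneg (by positivity) hP)
      _ = 2 ^ 20 / 12108 ^ 3 * klScaleZeroCV R * klScaleZeroThetaC R ^ 2 * ms * U ^ 3 := by ring
  -- (3) assemble: `‖a‖ ≤ ‖a − t‖ + ‖t‖`
  rw [hsplit]
  set t : ℂ := ((((4 : ℕ).factorial : ℝ) * (β * (L : ℝ) ^ 2) ^ (4 - 1) : ℝ) : ℂ) *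
    (kernel ℂ (gaussConv ℂ (softCovOf L M β μ K (softSymbolCompl L M β μ K 0 j') + normalCovariance L M sd)
        (effAction ℂ (normalCovariance L M sC) (hubbardInteractionCT L M β U K) - gaussConv ℂ (normalCovariance L M sC) (hubbardInteractionCT L M β U K) +
          (2 : ℂ)⁻¹ • (gaussConv ℂ (normalCovariance L M sC) (hubbardInteractionCT L M β U K * hubbardInteractionCT L M β U K) -
            gaussConv ℂ (normalCovariance L M sC) (hubbardInteractionCT L M β U K) * gaussConv ℂ (normalCovariance L M sC) (hubbardInteractionCT L M β U K)))) 4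
        (pairLegs L M Qm k k') -
      kernel ℂ (gaussConv ℂ (softCovOf L M β μ K (softSymbolCompl L M β μ K 0 j'))
        (effAction ℂ (normalCovariance L M sC) (hubbardInteractionCT L M β U K) - gaussConv ℂ (normalCovariance L M sC) (hubbardInteractionCT L M β U K) +
          (2 : ℂ)⁻¹ • (gaussConv ℂ (normalCovariance L M sC) (hubbardInteractionCT L M β U K * hubbardInteractionCT L M β U K) -
            gaussConv ℂ (normalCovariance L M sC) (hubbardInteractionCT L M β U K) * gaussConv ℂ (normalCovariance L M sC) (hubbardInteractionCT L M β U K)))) 4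
        (pairLegs L M Qm k k')) with ht
  have htn : ‖t‖ ≤ 2 ^ 20 / 12108 ^ 3 * klScaleZeroCV R * klScaleZeroThetaC R ^ 2 * ms * U ^ 3 := by
    refine le_trans (le_of_eq ?_) (htail.trans htail')
    rw [ht, vertexFn_def, vertexFn_def, ← mul_sub, hC, hd, add_comm (normalCovariance L M sd)]
  calc _ = ‖(klCovSmearedPairAmplitude L M β U μ K 0 (softCovOf L M β μ K (softSymbolCompl L M β μ K 0 j') + normalCovariance L M sd) Qm k k' -
          klCovSmearedPairAmplitude L M β U μ K 0 (softCovOf L M β μ K (softSymbolCompl L M β μ K 0 j')) Qm k k' - t) + t‖ := by rw [sub_add_cancel]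
    _ ≤ ‖klCovSmearedPairAmplitude L M β U μ K 0 (softCovOf L M β μ K (softSymbolCompl L M β μ K 0 j') + normalCovariance L M sd) Qm k k' -
          klCovSmearedPairAmplitude L M β U μ K 0 (softCovOf L M β μ K (softSymbolCompl L M β μ K 0 j')) Qm k k' - t‖ + ‖t‖ := norm_add_le _ _
    _ ≤ 40 * U ^ 2 * (2 * (β * (L : ℝ) ^ 2) / klScale klE0 0) * (∑ p, ‖sd p‖) / |β * (L : ℝ) ^ 2| ^ 3 +
          2 ^ 20 / 12108 ^ 3 * klScaleZeroCV R * klScaleZeroThetaC R ^ 2 * ms * U ^ 3 := add_le_add (by rw [ht]; exact hexp) htn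
    _ ≤ 160 * ms * U ^ 2 + 2 ^ 20 / 12108 ^ 3 * klScaleZeroCV R * klScaleZeroThetaC R ^ 2 * ms * U ^ 3 := by linarith [hexp']

end Summit.HubbardSuperconductivity.HubbardSuperconductivity.Theorems.EngineV8

end
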